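import Summits.FinalStateConjecture.FinalStateConjecture.Theorems.PhotonSphereChannelsWindowedShellChannelsGlueCore
import Summits.FinalStateConjecture.FinalStateConjecture.Theorems.PhotonSphereChannelsWindowedShellChannelsGlueShares

/-!
# Crux `WindowedShellChannels` (stmt-FinalStateConjecture-14085), line `Sketch` — stub `stub_glue`
# (the composition of skeleton v8: the ℓ-uniform residue from the six pieces)

`stub_glue σ hZ hF hS hD hL1 hL2` proves the caught-form ℓ-uniform residue `stub_coreHigh σ` from the six
registered pieces of skeleton v8 (lead c3): the polynomial-zone kernel `hZ` (`stub_zonePoly σ`), the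
explicit-threshold far share `hF` (`stub_farPolyShare`), the layer split `hS` (`stub_layerSplit σ`), the
drop PSD-subadditivity `hD` (`stub_dropPSD`) and the two late-drop bounds `hL1`, `hL2`
(`stub_lateDropInvSq`, `stub_lateDropExp`).

Parameters (given `ρ`; `h₀, c₀` from `hZ`, `A` from `hF`): `c₁ = min c₀ (1/128)`, `η = c₁/16`,
`ε = c₁²/1024`, `N = ⌈32000/c₁²⌉₊ + 1` (so `δ = 1000/N ≤ c₁²/32`), lag `h = max h₀ ρ + 1` (`H = h − ρ ≥ 1`),
`C_R = A + 2·10¹⁰/ε + H + ρ + 10`, per mode `Λ = 1000(ℓ+1)²/ε`, `Rs = C_R(ℓ+1)⁴`, zone degree `k = 2N + 5`,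
threshold `max ℓ_Z(k) ⌈C_R(1000/ε)^N⌉₊`; times `T_f = ΛL/4 − L − 1`, `T_n = 4L − 1`; constant `c₁/4`.
The analytic content is `Glue.glue_core` (file `…GlueCore`); this file only checks the numerology.
No definitions. [folklore]
-/

noncomputable section

set_option linter.dupNamespace false

open Set Filter Topology Function MeasureTheory
open scoped ENNReal

namespace Summit.FinalStateConjecture.FinalStateConjecture.Theorems.WindowedShellChannelsSketch

open Literature.Geometry.Lorentzian Literature.Geometry.Lorentzian.ReggeWheeler
open Summit.FinalStateConjecture.FinalStateConjecture.Theorems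
open Summit.FinalStateConjecture.FinalStateConjecture.Theorems.CauchyWaveGlobal
open Summit.FinalStateConjecture.FinalStateConjecture.Theorems.WindowedShellChannelsStubs
open Glue

set_option maxHeartbeats 1000000 in
/-- **The composition `stub_glue σ`** of skeleton v8 (registered signature).  See the module docstring.
[folklore in method; new] -/
theorem stub_glue (σ : ℝ)
    (hZ : ∀ ρ : ℝ, 0 < ρ → ∃ h : ℝ, 0 ≤ h ∧ ∃ c : ℝ, 0 < c ∧ ∀ k : ℕ, ∃ ℓ₀ : ℕ,
      ∀ (s ℓ : ℕ), s ≤ 2 → s ≤ ℓ → ℓ₀ ≤ ℓ → ∀ ψ : ℝ → ℝ → ℝ,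
        IsRWSolution 1 s ℓ (tortoiseRadius one_pos 0) ψ → (∀ t x, ψ (-t) x = σ * ψ t x) →
        CauchyDataSupportedOn ψ ({x : ℝ | ρ < |x|} ∩ Icc (-(((ℓ : ℝ) + 2) ^ k)) (((ℓ : ℝ) + 2) ^ k)) →
        totalEnergy (linePotential 1 s ℓ (tortoiseRadius one_pos 0)) ψ 0 ≠ ⊤ →
          ENNReal.ofReal c * totalEnergy (linePotential 1 s ℓ (tortoiseRadius one_pos 0)) ψ 0 ≤
            channelEnergy (linePotential 1 s ℓ (tortoiseRadius one_pos 0)) 0 (ρ - h) ψ atTop)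
    (hF : ∃ A : ℝ, 0 < A ∧ ∀ (s ℓ : ℕ), s ≤ 2 → s ≤ ℓ → ∀ ψ : ℝ → ℝ → ℝ,
      IsRWSolution 1 s ℓ (tortoiseRadius one_pos 0) ψ →
      CauchyDataSupportedOn ψ (Ioi (A * ((ℓ : ℝ) + 1) ^ 4)) →
      totalEnergy (linePotential 1 s ℓ (tortoiseRadius one_pos 0)) ψ 0 ≠ ⊤ →
        ENNReal.ofReal (1 / 64) * totalEnergy (linePotential 1 s ℓ (tortoiseRadius one_pos 0)) ψ 0 ≤
          farChannelEnergy (linePotential 1 s ℓ (tortoiseRadius one_pos 0)) 0 ψ atTop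
            + farChannelEnergy (linePotential 1 s ℓ (tortoiseRadius one_pos 0)) 0 ψ atBot)
    (hS : ∀ (s ℓ : ℕ), s ≤ ℓ → ∀ ρ : ℝ, 0 < ρ → ∀ Λ : ℝ, 20 ≤ Λ → ∀ N : ℕ, 1 ≤ N →
      ∀ Rs : ℝ, ρ + 1 ≤ Rs → ∀ ψ : ℝ → ℝ → ℝ,
      IsRWSolution 1 s ℓ (tortoiseRadius one_pos 0) ψ → (∀ t x, ψ (-t) x = σ * ψ t x) →
      CauchyDataSupportedOn ψ {x : ℝ | ρ < |x|} →
      totalEnergy (linePotential 1 s ℓ (tortoiseRadius one_pos 0)) ψ 0 ≠ ⊤ →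
      ∃ L : ℝ, Rs ≤ L ∧ Λ * L ≤ Rs * Λ ^ N ∧ ∃ ψz ψn ψf ψg : ℝ → ℝ → ℝ,
        IsRWSolution 1 s ℓ (tortoiseRadius one_pos 0) ψz ∧ IsRWSolution 1 s ℓ (tortoiseRadius one_pos 0) ψn ∧
        IsRWSolution 1 s ℓ (tortoiseRadius one_pos 0) ψf ∧ IsRWSolution 1 s ℓ (tortoiseRadius one_pos 0) ψg ∧
        (∀ t x, ψ t x = ψz t x + ψn t x + ψf t x + ψg t x) ∧
        (∀ t x, ψz (-t) x = σ * ψz t x) ∧ (∀ t x, ψn (-t) x = σ * ψn t x) ∧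
        (∀ t x, ψf (-t) x = σ * ψf t x) ∧ (∀ t x, ψg (-t) x = σ * ψg t x) ∧
        CauchyDataSupportedOn ψz ({x : ℝ | ρ < |x|} ∩ Icc (-(2 * L)) (2 * L)) ∧
        CauchyDataSupportedOn ψn (Iio (-(10 * L))) ∧
        CauchyDataSupportedOn ψf (Ioi (Λ * L / 2)) ∧
        totalEnergy (linePotential 1 s ℓ (tortoiseRadius one_pos 0)) ψz 0
            + totalEnergy (linePotential 1 s ℓ (tortoiseRadius one_pos 0)) ψn 0
            + totalEnergy (linePotential 1 s ℓ (tortoiseRadius one_pos 0)) ψf 0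
          ≤ ENNReal.ofReal (1 + 1000 / N) * totalEnergy (linePotential 1 s ℓ (tortoiseRadius one_pos 0)) ψ 0 ∧
        totalEnergy (linePotential 1 s ℓ (tortoiseRadius one_pos 0)) ψg 0
          ≤ ENNReal.ofReal (1000 / N) * totalEnergy (linePotential 1 s ℓ (tortoiseRadius one_pos 0)) ψ 0)
    (hD : ∀ (V : ℝ → ℝ), Differentiable ℝ V → (∀ x, 0 ≤ V x) →
      ∀ u v : ℝ → ℝ → ℝ, IsSolution V u → IsSolution V v → totalEnergy V u 0 ≠ ⊤ → totalEnergy V v 0 ≠ ⊤ →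
      ∀ a η T t : ℝ, 0 < η → 0 ≤ T → T ≤ t →
        farEnergy V a (fun t x => u t x + v t x) T
            + ENNReal.ofReal (1 + η) * farEnergy V a u t + ENNReal.ofReal (1 + η⁻¹) * farEnergy V a v t
          ≤ farEnergy V a (fun t x => u t x + v t x) t
            + ENNReal.ofReal (1 + η) * farEnergy V a u T + ENNReal.ofReal (1 + η⁻¹) * farEnergy V a v T)
    (hL1 : ∀ (V : ℝ → ℝ) (K : ℝ), Differentiable ℝ V → (∀ x, 0 ≤ V x) → 1 ≤ K →
      (∀ x, 1 ≤ x → V x ≤ K / x ^ 2) →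
      ∀ R H T : ℝ, 1 ≤ R → 0 ≤ H → H + K * (R + H + 2) ≤ T → ∀ ψ : ℝ → ℝ → ℝ, IsSolution V ψ →
        CauchyDataSupportedOn ψ (Icc (-R) R) →
          farEnergy V (-H) ψ T ≤ farChannelEnergy V (-H) ψ atTop
            + ENNReal.ofReal (8 * K * (R + H + 2) / (T - H)) * totalEnergy V ψ 0)
    (hL2 : ∀ (V : ℝ → ℝ) (K : ℝ), Differentiable ℝ V → (∀ x, 0 ≤ V x) → 1 ≤ K →
      (∀ x, V x ≤ K * Real.exp (-x / 2)) →
      ∀ R H T : ℝ, 1 ≤ R → 0 ≤ H → R + 2 * H + 2 ≤ T → ∀ ψ : ℝ → ℝ → ℝ, IsSolution V ψ →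
        CauchyDataSupportedOn ψ (Icc (-R) R) →
          farEnergy V (-H) ψ T ≤ farChannelEnergy V (-H) ψ atTop
            + ENNReal.ofReal (8 * K ^ 2 * (R + H + 2) ^ 3 * Real.exp ((H - T) / 2)) * totalEnergy V ψ 0) :
    ∀ ρ : ℝ, 0 < ρ → ∃ ℓ₀ : ℕ, ∃ h : ℝ, 0 ≤ h ∧ ∃ c : ℝ, 0 < c ∧
    ∀ (s ℓ : ℕ), s ≤ 2 → s ≤ ℓ → ℓ₀ ≤ ℓ → ∀ ψ : ℝ → ℝ → ℝ,
        IsRWSolution 1 s ℓ (tortoiseRadius one_pos 0) ψ → (∀ t x, ψ (-t) x = σ * ψ t x) →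
        CauchyDataSupportedOn ψ {x : ℝ | ρ < |x|} →
        totalEnergy (linePotential 1 s ℓ (tortoiseRadius one_pos 0)) ψ 0 ≠ ⊤ →
          ENNReal.ofReal c * totalEnergy (linePotential 1 s ℓ (tortoiseRadius one_pos 0)) ψ 0 ≤
            channelEnergy (linePotential 1 s ℓ (tortoiseRadius one_pos 0)) 0 (ρ - h) ψ atTop := by
  intro ρ hρ
  obtain ⟨h₀, hh₀, c₀, hc₀, HZ⟩ := hZ ρ hρ
  obtain ⟨A, hA, HF⟩ := hF
  -- the constants
  obtain ⟨c₁, hc₁⟩ : ∃ c₁ : ℝ, c₁ = min c₀ (1 / 128) := ⟨_, rfl⟩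
  have hc₁0 : 0 < c₁ := by rw [hc₁]; exact lt_min hc₀ (by norm_num)
  have hc₁1 : c₁ ≤ 1 / 128 := by rw [hc₁]; exact min_le_right _ _
  have hc₁c₀ : c₁ ≤ c₀ := by rw [hc₁]; exact min_le_left _ _
  have hc₁le1 : c₁ ≤ 1 := hc₁1.trans (by norm_num)
  obtain ⟨ε, hεdef⟩ : ∃ ε : ℝ, ε = c₁ ^ 2 / 1024 := ⟨_, rfl⟩
  have hε0 : 0 < ε := by rw [hεdef]; positivity
  have hε1 : ε ≤ 1 := by rw [hεdef]; nlinarith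
  obtain ⟨N, hNdef⟩ : ∃ N : ℕ, N = ⌈32000 / c₁ ^ 2⌉₊ + 1 := ⟨_, rfl⟩
  have hN1 : 1 ≤ N := by rw [hNdef]; exact Nat.le_add_left 1 _
  have hNreal : 32000 / c₁ ^ 2 ≤ (N : ℝ) := by
    rw [hNdef]; push_cast
    exact (Nat.le_ceil _).trans (by linarith)
  have hNpos : (0 : ℝ) < N := by exact_mod_cast hN1
  have hδ0 : (0 : ℝ) ≤ 1000 / N := by positivity
  have hδ1 : (1000 : ℝ) / N ≤ c₁ ^ 2 / 32 := by
    rw [div_le_div_iff₀ hNpos (by norm_num)]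
    have : 32000 / c₁ ^ 2 * c₁ ^ 2 ≤ (N : ℝ) * c₁ ^ 2 := mul_le_mul_of_nonneg_right hNreal (by positivity)
    rw [div_mul_cancel₀ _ (by positivity)] at this
    linarith
  obtain ⟨h, hhdef⟩ : ∃ h : ℝ, h = max h₀ ρ + 1 := ⟨_, rfl⟩
  have hhh₀ : h₀ ≤ h := by rw [hhdef]; linarith [le_max_left h₀ ρ]
  have hhρ : ρ + 1 ≤ h := by rw [hhdef]; linarith [le_max_right h₀ ρ]
  have hh0 : 0 ≤ h := hh₀.trans hhh₀
  obtain ⟨H, hHdef⟩ : ∃ H : ℝ, H = h - ρ := ⟨_, rfl⟩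
  have hH1 : 1 ≤ H := by rw [hHdef]; linarith
  have hH0 : 0 ≤ H := by linarith
  obtain ⟨CR, hCRdef⟩ : ∃ CR : ℝ, CR = A + 2 * 10 ^ 10 / ε + H + ρ + 10 := ⟨_, rfl⟩
  have hXε : 0 ≤ 2 * 10 ^ 10 / ε := by positivity
  have hCR10 : 10 ≤ CR := by rw [hCRdef]; linarith
  have hCRA : A ≤ CR := by rw [hCRdef]; linarith
  have hCRε : 2 * 10 ^ 10 / ε ≤ CR := by rw [hCRdef]; linarith
  have hCRH : H + ρ + 10 ≤ CR := by rw [hCRdef]; linarith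
  have hCR0 : 0 ≤ CR := by linarith
  obtain ⟨CZ, hCZdef⟩ : ∃ CZ : ℝ, CZ = CR * (1000 / ε) ^ N := ⟨_, rfl⟩
  obtain ⟨ℓZ, HZk⟩ := HZ (2 * N + 5)
  refine ⟨max ℓZ ⌈CZ⌉₊, h, hh0, c₁ / 4, by positivity, ?_⟩
  intro s ℓ hs hsℓ hℓ ψ hψ hpar hsupp hE
  have hℓZ : ℓZ ≤ ℓ := le_of_max_le_left hℓ
  have hℓCZ : CZ ≤ (ℓ : ℝ) + 2 := by
    have h1 : (⌈CZ⌉₊ : ℝ) ≤ ℓ := by exact_mod_cast le_of_max_le_right hℓ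
    linarith [Nat.le_ceil CZ]
  -- the mode
  have hr := isTortoiseRadius_tortoiseRadius one_pos (0 : ℝ)
  set V : ℝ → ℝ := linePotential 1 s ℓ (tortoiseRadius one_pos 0) with hVdef
  have hVd : Differentiable ℝ V := RW.differentiable_linePotential hr s ℓ
  have hV0 : ∀ x, 0 ≤ V x := fun x => (RW.linePotential_pos hr hsℓ x).le
  have hVr : Differentiable ℝ (fun x => V (-x)) := hVd.comp differentiable_neg
  have hVr0 : ∀ x, 0 ≤ V (-x) := fun x => hV0 _
  obtain ⟨lr, hlr⟩ : ∃ lr : ℝ, lr = (ℓ : ℝ) + 1 := ⟨_, rfl⟩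
  have hℓ0 : (0 : ℝ) ≤ ℓ := by positivity
  have hlr1 : 1 ≤ lr := by rw [hlr]; linarith
  have hlr0 : 0 ≤ lr := by linarith
  have hlr2 : 1 ≤ lr ^ 2 := one_le_pow₀ hlr1
  have hlr4 : 1 ≤ lr ^ 4 := one_le_pow₀ hlr1
  -- per-mode parameters
  obtain ⟨Λ, hΛdef⟩ : ∃ Λ : ℝ, Λ = 1000 * lr ^ 2 / ε := ⟨_, rfl⟩
  have hΛ1000 : 1000 * lr ^ 2 ≤ Λ := by
    rw [hΛdef, le_div_iff₀ hε0]
    exact mul_le_of_le_one_right (by positivity) hε1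
  have hΛ20 : 20 ≤ Λ := by
    have : (1000 : ℝ) ≤ 1000 * lr ^ 2 := by nlinarith
    linarith
  have hΛ2 : 2 ≤ Λ := by linarith
  obtain ⟨Rs, hRsdef⟩ : ∃ Rs : ℝ, Rs = CR * lr ^ 4 := ⟨_, rfl⟩
  have hRsCR : CR ≤ Rs := by rw [hRsdef]; exact le_mul_of_one_le_right hCR0 hlr4
  have hRsρ : ρ + 1 ≤ Rs := by linarith
  -- split
  obtain ⟨L, hRsL, hΛL, z, n, f, g, hz, hn, hf, hg, hsum, pz, pn, pf, _, sz, sn, sf, hEsum, hEg⟩ :=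
    hS s ℓ hsℓ ρ hρ Λ hΛ20 N hN1 Rs hRsρ ψ hψ hpar hsupp hE
  -- facts about `L`
  have hLCR : CR ≤ L := hRsCR.trans hRsL
  have hL10 : 10 ≤ L := hCR10.trans hLCR
  have hLH : H + 2 ≤ L := by linarith
  have hRsL' : CR * lr ^ 4 ≤ L := by rw [hRsdef] at hRsL; exact hRsL
  have hLA : A * lr ^ 4 ≤ L := (mul_le_mul_of_nonneg_right hCRA (by positivity)).trans hRsL'
  have hLlr : lr ^ 4 ≤ L := by
    have : 1 * lr ^ 4 ≤ CR * lr ^ 4 := mul_le_mul_of_nonneg_right (by linarith) (by positivity)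
    linarith
  have hLε : 2 * 10 ^ 10 / ε ≤ L := hCRε.trans hLCR
  have hL0 : 0 ≤ L := by linarith
  obtain ⟨p, hp⟩ : ∃ p : ℝ, p = lr ^ 2 * L := ⟨_, rfl⟩
  have hpL : L ≤ p := by rw [hp]; exact le_mul_of_one_le_left hL0 hlr2
  have hp0 : 0 ≤ p := hL0.trans hpL
  have hΛLp : Λ * L / 4 = 250 * p / ε := by rw [hΛdef, hp]; ring
  have hΛL4 : 250 * p ≤ Λ * L / 4 := by
    rw [hΛLp, le_div_iff₀ hε0]
    exact mul_le_of_le_one_right (by positivity) hε1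
  -- the times
  obtain ⟨Tf, hTfdef⟩ : ∃ Tf : ℝ, Tf = Λ * L / 4 - L - 1 := ⟨_, rfl⟩
  obtain ⟨Tn, hTndef⟩ : ∃ Tn : ℝ, Tn = 4 * L - 1 := ⟨_, rfl⟩
  have hTfH : 248 * p ≤ Tf - H := by rw [hTfdef]; linarith
  have hTf0 : H ≤ Tf := by linarith
  have hTn0 : H ≤ Tn := by rw [hTndef]; linarith
  -- finite energies of the pieces
  have hfinS : totalEnergy V z 0 + totalEnergy V n 0 + totalEnergy V f 0 ≠ ⊤ :=
    ne_top_of_le_ne_top (ENNReal.mul_ne_top ENNReal.ofReal_ne_top hE) hEsum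
  have hEz : totalEnergy V z 0 ≠ ⊤ := ne_top_of_le_ne_top hfinS (le_add_right (le_add_right le_rfl))
  have hEn : totalEnergy V n 0 ≠ ⊤ := ne_top_of_le_ne_top hfinS (le_add_right (le_add_left le_rfl))
  have hEf : totalEnergy V f 0 ≠ ⊤ := ne_top_of_le_ne_top hfinS (le_add_left le_rfl)
  have hEg' : totalEnergy V g 0 ≠ ⊤ :=
    ne_top_of_le_ne_top (ENNReal.mul_ne_top ENNReal.ofReal_ne_top hE) hEg
  -- supports of the zone piece
  have hzIcc : CauchyDataSupportedOn z (Icc (-(2 * L)) (2 * L)) := supported_mono sz inter_subset_right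
  have hsz : CauchyDataSupportedOn z (Iio (2 * L + 1 / 2)) :=
    supported_mono hzIcc fun x hx => by simp only [mem_Icc] at hx; simp only [mem_Iio]; linarith
  have hszf : CauchyDataSupportedOn z (Ioi (-(2 * L + 1 / 2))) :=
    supported_mono hzIcc fun x hx => by simp only [mem_Icc] at hx; simp only [mem_Ioi]; linarith
  have hszr : CauchyDataSupportedOn (fun t x => z t (-x)) (Iio (2 * L + 1 / 2)) :=
    supported_mono (supported_reflect_Icc hzIcc) fun x hx => by
      simp only [mem_Icc] at hx; simp only [mem_Iio]; linarith
  -- (SZ) the zone share from the kernel `hZ` at degree `2N + 5`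
  have hP : 2 * L ≤ ((ℓ : ℝ) + 2) ^ (2 * N + 5) := by
    have h1 : 2 * L ≤ Rs * Λ ^ N := by
      have : 2 * L ≤ Λ * L := mul_le_mul_of_nonneg_right hΛ2 hL0
      linarith
    have h2 : Rs * Λ ^ N = CZ * lr ^ (2 * N + 4) := by
      have e : 1000 * lr ^ 2 / ε = 1000 / ε * lr ^ 2 := by ring
      rw [hRsdef, hΛdef, hCZdef, e, mul_pow, ← pow_mul, pow_add]; ring
    have hb : lr + 1 = (ℓ : ℝ) + 2 := by rw [hlr]; ring
    have h3 : CZ * lr ^ (2 * N + 4) ≤ (lr + 1) * (lr + 1) ^ (2 * N + 4) := by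
      have hCZ0 : 0 ≤ CZ := by rw [hCZdef]; positivity
      apply mul_le_mul (by linarith) (pow_le_pow_left₀ hlr0 (by linarith) _)
        (by positivity) (by linarith)
    have h4 : (lr + 1) * (lr + 1) ^ (2 * N + 4) = ((ℓ : ℝ) + 2) ^ (2 * N + 5) := by
      have : 2 * N + 5 = (2 * N + 4) + 1 := by ring
      rw [hb, this, pow_succ]; ring
    linarith
  have hzone : CauchyDataSupportedOn z
      ({x : ℝ | ρ < |x|} ∩ Icc (-(((ℓ : ℝ) + 2) ^ (2 * N + 5))) (((ℓ : ℝ) + 2) ^ (2 * N + 5))) :=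
    supported_mono sz (inter_subset_inter_right _ (Icc_subset_Icc (by linarith) hP))
  have SZ : ENNReal.ofReal c₁ * totalEnergy V z 0 ≤ channelEnergy V 0 (-H) z atTop := by
    have h1 := HZk s ℓ hs hsℓ hℓZ z hz pz hzone hEz
    have h2 : channelEnergy V 0 (ρ - h₀) z atTop ≤ channelEnergy V 0 (-H) z atTop :=
      Parity.channelEnergy_mono_aperture V 0 (by rw [hHdef]; linarith) z atTop
    exact (mul_le_mul_of_nonneg_right (ENNReal.ofReal_le_ofReal hc₁c₀) (zero_le)).trans (h1.trans h2)
  -- (SF) the far share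
  have SF : ENNReal.ofReal (1 / 128) * totalEnergy V f 0 ≤ farChannelEnergy V (-H) f atTop := by
    have hsuppf : CauchyDataSupportedOn f (Ioi (A * ((ℓ : ℝ) + 1) ^ 4)) := by
      refine supported_mono sf (Ioi_subset_Ioi ?_)
      rw [← hlr]
      have : 2 * L ≤ Λ * L := mul_le_mul_of_nonneg_right hΛ2 hL0
      linarith
    exact farShare_of_twoSided pf (HF s ℓ hs hsℓ f hf hsuppf hEf) hH0
  -- (SN) the near share, reflected
  have SN : ENNReal.ofReal (1 / 4) * totalEnergy V n 0
      ≤ farChannelEnergy (fun x => V (-x)) (-H) (fun t x => n t (-x)) atTop := by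
    have hsuppn : CauchyDataSupportedOn n (Iio (-9)) :=
      supported_mono sn (Iio_subset_Iio (by linarith))
    exact nearShare_reflect hs hsℓ hn pn hsuppn hH0
  -- (LF) the far late drop of the zone piece
  have LF : farEnergy V (-H) z Tf ≤ farChannelEnergy V (-H) z atTop + ENNReal.ofReal ε * totalEnergy V z 0 := by
    have hK1 : (1 : ℝ) ≤ 9 * lr ^ 2 := by linarith
    have hVb : ∀ x, 1 ≤ x → V x ≤ 9 * lr ^ 2 / x ^ 2 := fun x hx => by
      rw [hlr]; exact linePotential_le_inv_sq hsℓ hx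
    have hR1 : (1 : ℝ) ≤ 2 * L := by linarith
    have h3L : 9 * lr ^ 2 * (2 * L + H + 2) ≤ 27 * p := by
      calc 9 * lr ^ 2 * (2 * L + H + 2) ≤ 9 * lr ^ 2 * (3 * L) :=
            mul_le_mul_of_nonneg_left (by linarith) (by positivity)
        _ = 27 * p := by rw [hp]; ring
    have hT : H + 9 * lr ^ 2 * (2 * L + H + 2) ≤ Tf := by linarith
    have h1 := hL1 V (9 * lr ^ 2) hVd hV0 hK1 hVb (2 * L) H Tf hR1 hH0 hT z hz hzIcc
    have hcoef : 8 * (9 * lr ^ 2) * (2 * L + H + 2) / (Tf - H) ≤ ε := by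
      rw [div_le_iff₀ (by linarith)]
      have e1 : 8 * (9 * lr ^ 2) * (2 * L + H + 2) ≤ 216 * p := by linarith
      have e2 : 248 * p ≤ ε * (Tf - H) := by
        have : ε * (Tf - H) = ε * (Λ * L / 4) - ε * (L + 1 + H) := by rw [hTfdef]; ring
        have e3 : ε * (Λ * L / 4) = 250 * p := by rw [hΛLp, mul_comm, div_mul_cancel₀ _ hε0.ne']
        have e4 : ε * (L + 1 + H) ≤ 2 * p :=
          calc ε * (L + 1 + H) ≤ 1 * (L + 1 + H) := mul_le_mul_of_nonneg_right hε1 (by linarith)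
            _ ≤ 2 * p := by linarith
        linarith
      linarith
    exact h1.trans (add_le_add_right (mul_le_mul_of_nonneg_right (ENNReal.ofReal_le_ofReal hcoef) (zero_le)) _)
  -- (LN) the late drop of the zone piece on the reflected near side
  have LN : farEnergy (fun x => V (-x)) (-H) (fun t x => z t (-x)) Tn
      ≤ farChannelEnergy (fun x => V (-x)) (-H) (fun t x => z t (-x)) atTop
        + ENNReal.ofReal ε * totalEnergy (fun x => V (-x)) (fun t x => z t (-x)) 0 := by
    have hVb : ∀ x, V (-x) ≤ lr ^ 2 * Real.exp (-x / 2) := fun x => by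
      rw [hlr]; exact linePotential_le_exp hsℓ (-x)
    have hR1 : (1 : ℝ) ≤ 2 * L := by linarith
    have hT : 2 * L + 2 * H + 2 ≤ Tn := by rw [hTndef]; linarith
    have h1 := hL2 (fun x => V (-x)) (lr ^ 2) hVr hVr0 hlr2 hVb (2 * L) H Tn hR1 hH0 hT
      (fun t x => z t (-x)) (isSolution_reflect hz) (supported_reflect_Icc hzIcc)
    have hcoef : 8 * (lr ^ 2) ^ 2 * (2 * L + H + 2) ^ 3 * Real.exp ((H - Tn) / 2) ≤ ε := by
      rw [hTndef, hlr]
      exact near_late_small hH0 hε0 hLH (by rw [← hlr]; exact hLlr) hLε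
    exact h1.trans (add_le_add_right (mul_le_mul_of_nonneg_right (ENNReal.ofReal_le_ofReal hcoef) (zero_le)) _)
  -- the composition inequality
  have hsepf : 2 * L + 1 / 2 + Tf < Λ * L / 2 - Tf := by rw [hTfdef]; linarith only [hL0]
  have hsepn : 2 * L + 1 / 2 + Tn < 10 * L - Tn := by rw [hTndef]; linarith only [hL0]
  have hAzBf : 2 * L + 1 / 2 ≤ Λ * L / 2 := by linarith only [hΛL4, hpL, hL10]
  have core := glue_core hVd hV0 hD hψ hz hn hf hg hsum hE hEz hEn hEf hEg' hH0 (by positivity) hAzBf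
    hsz hszr hszf sn sf hTf0 hTn0 hsepf hsepn hc₁0.le hc₁le1 (by norm_num : (0 : ℝ) ≤ 1 / 128)
    (by norm_num : (0 : ℝ) ≤ 1 / 4) hε0.le (by positivity : (0 : ℝ) < c₁ / 16) hδ0 SZ SF SN LF LN
    hEsum hEg
  -- the final constant
  have hmin : min c₁ (min (1 / 128 : ℝ) (1 / 4)) = c₁ := by
    rw [min_eq_left (show (1 : ℝ) / 128 ≤ 1 / 4 by norm_num)]; exact min_eq_left hc₁1
  rw [hmin] at core
  have hκ := kappa_ge hc₁0 hc₁le1 hδ0 hδ1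
  rw [← hεdef] at hκ
  have hgoal : ρ - h = -H := by rw [hHdef]; ring
  rw [hgoal]
  exact (mul_le_mul_of_nonneg_right (ENNReal.ofReal_le_ofReal hκ) (zero_le)).trans core

end Summit.FinalStateConjecture.FinalStateConjecture.Theorems.WindowedShellChannelsSketch

end
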